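import Mathlib
import Summits.KontsevichZagierPeriods.Zeta5Search.DenomLaw.RuleR1CellTS5
import Summits.KontsevichZagierPeriods.Zeta5Search.DenomLaw.RuleR1CellTS7
import Summits.KontsevichZagierPeriods.Zeta5Search.DenomLaw.RuleR1CellTS10
import Summits.KontsevichZagierPeriods.Zeta5Search.DenomLaw.RuleR
import HarnessLib

/-!
# ζ(5) search — the RULE-R1 node on TOP_STAIR rays TS5, TS7, TS10: `RuleR1Casoratian`'s conclusion for `b := b(n)`, binders VERBATIM, every `n ≥ 1`

Cell `pub-zeta5` (HONEST FRAMING: systematic search; no irrationality claim unless certified), TRACK «DENOM-LAW» D1 prover seat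
(denom-prover-d1 g14, `HOME/denom-law/prover-d1/ATTEMPT-14.md` §3; companion of `DenomLaw/TS3RayRuleR1`).  Engine-d2's typed node `DenomLaw.RuleR1Casoratian`
(TYPE-LAW v2, rule R1: at `⌊d/p⌋ = 1` with `a = a_p(b) ≥ 1` parameters reaching `p` and the antipodal matching of the other six reaching `p`,
`v_p(Cas₇(b)) ≥ (a + 1) − N_p`, one unit above the PATH accounting; OBSERVED/CONJECTURED for general `b`) is a THEOREM for every `n ≥ 1` on each of the
three other TOP_STAIR rays where it fires: on each ray the node's hypotheses single out ONE θ-cell (`⌊d/p⌋ = 1` ⇒ `dn < 2p`; `a ≥ 1` ⇒ `p ≤ b₁` ⇒ `a = 1`;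
the matching block of length `33n` resp. `20n` ⇒ the upper end; the endpoint itself is never prime), on which `N_p = 9`, the value is `(1+1) − 9 = −7`, and
the landed prover-d1 g2 cells `RuleR1CellTS5/TS7/TS10.ruleR1_cell` (open windows `19n < p < 20n`, `32n < p < 33n`, `32n < p < 33n`, all `n`) supply it:
* TS5 `b(n) = n·(51; 21,19,18,16,15,13,12)` (`d = 39n`): cell `39n < 2p < 40n` — `StairTS5.ruleR1Casoratian_on_ts5`;
* TS7 `b(n) = n·(85; 34,32,30,27,25,22,20)` (`d = 65n`): cell `65n < 2p < 66n` — `StairTS7.ruleR1Casoratian_on_ts7`;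
* TS10 `b(n) = n·(85; 35,32,30,27,25,22,19)` (`d = 65n`): cell `65n < 2p < 66n` — `StairTS10.ruleR1Casoratian_on_ts10`.
(TOP_STAIR #3 is `DenomLaw/TS3RayRuleR1`; on TOP_STAIR #1, the record ray and the flag ray the R1 hypotheses never hold.)  Rule R2's hypotheses hold on none of
these rays.  MODEL/structure-side integer bookkeeping ray by ray; the ∀-`b` node stays CONJECTURED; nothing about ζ(5); no γ; records in print UNMOVED.
-/

open Finset

namespace Summit.KontsevichZagierPeriods.Zeta5Search.StairTS5

open Summit.KontsevichZagierPeriods.Zeta5Search.ClusterValuation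
open Summit.KontsevichZagierPeriods.Zeta5Search.CasoratianValuation (InPolytope shift casoratian pairFloors refund)
open Summit.KontsevichZagierPeriods.Zeta5Search.WedgeDictionary (dOf)
open Summit.KontsevichZagierPeriods.Zeta5Search.StaircaseCells (bRay ts5)
open Summit.KontsevichZagierPeriods.Zeta5Search.DenomLaw (Sorted7 FirstPeriod BlockGe longCount MatchingR1)

/-! ## TS5: `b(n) = n·(51; 21,19,18,16,15,13,12)`, `d = 39n`; the R1 cell `39n < 2p`, `p ≤ 20n` (`a = 1`, `N_p = 9`, value `−7`) -/

/-- `b_0 = 51n`. -/ theorem w0 (n : ℕ) : bRay ts5 n 0 = 51 * (n : ℤ) := by rw [v0]; push_cast; ring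
/-- `b_1 = 21n`. -/ theorem w1 (n : ℕ) : bRay ts5 n 1 = 21 * (n : ℤ) := by rw [v1]; push_cast; ring
/-- `b_2 = 19n`. -/ theorem w2 (n : ℕ) : bRay ts5 n 2 = 19 * (n : ℤ) := by rw [v2]; push_cast; ring
/-- `b_3 = 18n`. -/ theorem w3 (n : ℕ) : bRay ts5 n 3 = 18 * (n : ℤ) := by rw [v3]; push_cast; ring
/-- `b_4 = 16n`. -/ theorem w4 (n : ℕ) : bRay ts5 n 4 = 16 * (n : ℤ) := by rw [v4]; push_cast; ring
/-- `b_5 = 15n`. -/ theorem w5 (n : ℕ) : bRay ts5 n 5 = 15 * (n : ℤ) := by rw [v5]; push_cast; ring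
/-- `b_6 = 13n`. -/ theorem w6 (n : ℕ) : bRay ts5 n 6 = 13 * (n : ℤ) := by rw [v6]; push_cast; ring
/-- `b_7 = 12n`. -/ theorem w7 (n : ℕ) : bRay ts5 n 7 = 12 * (n : ℤ) := by rw [v7]; push_cast; ring

/-- `d = 39n`. -/
theorem dOf_lin (n : ℕ) : dOf (bRay ts5 n) = 39 * (n : ℤ) := by rw [dOf_ray]; push_cast; ring

/-- On `39n < 2p`, `p ≤ 21n` exactly one parameter reaches `p` (`b₁ = 21n`): `a_p(b(n)) = 1`. -/
theorem longCount_r1 {n p : ℕ} (h1 : 39 * n < 2 * p) (h2 : p ≤ 21 * n) : longCount (bRay ts5 n) p = 1 := by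
  unfold longCount
  rw [card_eq_one]
  refine ⟨0, ?_⟩
  ext i
  simp only [mem_filter, mem_range, mem_singleton]
  constructor
  · rintro ⟨hi, hle⟩
    interval_cases i
    · rfl
    all_goals simp only [Nat.reduceAdd, w2, w3, w4, w5, w6, w7] at hle; omega
  · rintro rfl
    exact ⟨by norm_num, by rw [zero_add, w1]; exact_mod_cast h2⟩

/-- If some parameter reaches `p` then `p ≤ 21n`. -/
theorem le_top_of_longCount {n p : ℕ} (h : 1 ≤ longCount (bRay ts5 n) p) : p ≤ 21 * n := by
  unfold longCount at h
  obtain ⟨i, hi⟩ := card_pos.1 h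
  rw [mem_filter, mem_range] at hi
  obtain ⟨hi7, hle⟩ := hi
  interval_cases i <;> simp only [Nat.reduceAdd, w1, w2, w3, w4, w5, w6, w7] at hle <;> omega

/-- `N_p = 9` on the R1 cell `39n < 2p`, `p ≤ 20n`. -/
theorem pairFloors_r1 {n p : ℕ} (hA : 39 * n < 2 * p) (hB : p ≤ 20 * n) : pairFloors (bRay ts5 n) p = 9 := by
  have hp0 : (0 : ℤ) < p := by exact_mod_cast (show 0 < p by omega)
  have hq0 : ∀ (a b : ℤ) (c : ℕ), (51 : ℤ) - a - b = c → c * n < p →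
      ((51 : ℤ) * n - a * n - b * n) / (p : ℤ) = 0 := by
    intro a b c h h2
    rw [show (51 : ℤ) * n - a * n - b * n = (c : ℤ) * n by rw [← h]; ring]
    exact Int.ediv_eq_zero_of_lt (by positivity) (by exact_mod_cast h2)
  have hq1 : ∀ (a b : ℤ) (c : ℕ), (51 : ℤ) - a - b = c → p ≤ c * n → c * n < 2 * p →
      ((51 : ℤ) * n - a * n - b * n) / (p : ℤ) = 1 := by
    intro a b c h h1 h2
    rw [show (51 : ℤ) * n - a * n - b * n = (c : ℤ) * n by rw [← h]; ring]
    have h1' : (p : ℤ) ≤ c * n := by exact_mod_cast h1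
    have h2' : ((c * n : ℕ) : ℤ) < 2 * p := by exact_mod_cast h2
    push_cast at h2'
    rw [Int.ediv_eq_iff_of_pos hp0]; constructor <;> linarith
  unfold pairFloors
  simp only [sum_range_succ, sum_range_zero, zero_add, Nat.reduceAdd, w0, w1, w2, w3, w4, w5, w6, w7, Nat.lt_irrefl, if_false,
    show (0:ℕ) < 1 by norm_num, show (0:ℕ) < 2 by norm_num, show (0:ℕ) < 3 by norm_num, show (0:ℕ) < 4 by norm_num, show (0:ℕ) < 5 by norm_num,
    show (0:ℕ) < 6 by norm_num, show (1:ℕ) < 2 by norm_num, show (1:ℕ) < 3 by norm_num, show (1:ℕ) < 4 by norm_num, show (1:ℕ) < 5 by norm_num,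
    show (1:ℕ) < 6 by norm_num, show (2:ℕ) < 3 by norm_num, show (2:ℕ) < 4 by norm_num, show (2:ℕ) < 5 by norm_num, show (2:ℕ) < 6 by norm_num,
    show (3:ℕ) < 4 by norm_num, show (3:ℕ) < 5 by norm_num, show (3:ℕ) < 6 by norm_num, show (4:ℕ) < 5 by norm_num, show (4:ℕ) < 6 by norm_num,
    show (5:ℕ) < 6 by norm_num, if_true,
    show ¬ (1:ℕ) < 0 by norm_num, show ¬ (2:ℕ) < 0 by norm_num, show ¬ (3:ℕ) < 0 by norm_num, show ¬ (4:ℕ) < 0 by norm_num, show ¬ (5:ℕ) < 0 by norm_num,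
    show ¬ (6:ℕ) < 0 by norm_num, show ¬ (2:ℕ) < 1 by norm_num, show ¬ (3:ℕ) < 1 by norm_num, show ¬ (4:ℕ) < 1 by norm_num, show ¬ (5:ℕ) < 1 by norm_num,
    show ¬ (6:ℕ) < 1 by norm_num, show ¬ (3:ℕ) < 2 by norm_num, show ¬ (4:ℕ) < 2 by norm_num, show ¬ (5:ℕ) < 2 by norm_num, show ¬ (6:ℕ) < 2 by norm_num,
    show ¬ (4:ℕ) < 3 by norm_num, show ¬ (5:ℕ) < 3 by norm_num, show ¬ (6:ℕ) < 3 by norm_num, show ¬ (5:ℕ) < 4 by norm_num, show ¬ (6:ℕ) < 4 by norm_num,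
    show ¬ (6:ℕ) < 5 by norm_num, add_zero]
  rw [hq0 21 19 11 (by norm_num) (by omega), hq0 21 18 12 (by norm_num) (by omega), hq0 21 16 14 (by norm_num) (by omega), hq0 21 15 15 (by norm_num) (by omega), hq0 21 13 17 (by norm_num) (by omega), hq0 21 12 18 (by norm_num) (by omega), hq0 19 18 14 (by norm_num) (by omega), hq0 19 16 16 (by norm_num) (by omega), hq0 19 15 17 (by norm_num) (by omega), hq0 19 13 19 (by norm_num) (by omega), hq1 19 12 20 (by norm_num) (by omega) (by omega), hq0 18 16 17 (by norm_num) (by omega), hq0 18 15 18 (by norm_num) (by omega), hq1 18 13 20 (by norm_num) (by omega) (by omega), hq1 18 12 21 (by norm_num) (by omega) (by omega), hq1 16 15 20 (by norm_num) (by omega) (by omega), hq1 16 13 22 (by norm_num) (by omega) (by omega), hq1 16 12 23 (by norm_num) (by omega) (by omega), hq1 15 13 23 (by norm_num) (by omega) (by omega), hq1 15 12 24 (by norm_num) (by omega) (by omega), hq1 13 12 26 (by norm_num) (by omega) (by omega)]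
  norm_num

/-- `p = 20n` is impossible for a prime `p`. -/
theorem ne_top {n p : ℕ} (hprime : p.Prime) : p ≠ 20 * n := by
  intro heq
  have h : 2 ∣ p := ⟨10 * n, by omega⟩
  have := (Nat.prime_dvd_prime_iff_eq (by norm_num) hprime).1 h
  omega

/-- **The node `RuleR1Casoratian` restricted to TS5**, literally (all its binders, `b := b(n)`), for every `n ≥ 1`: its hypotheses force the cell
`39n < 2p < 40n` with `a = 1`, `N_p = 9`, where the value `(1 + 1) − 9 = −7` is the landed `RuleR1CellTS5.ruleR1_cell`. -/
theorem ruleR1Casoratian_on_ts5 (n p : ℕ) (hn : 1 ≤ n) (_hb : InPolytope (bRay ts5 n)) (_hs : Sorted7 (bRay ts5 n))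
    (_hb7 : InPolytope (shift (bRay ts5 n) 7)) (hprime : p.Prime) (_hp5 : 5 ≤ p) (_hwin : (bRay ts5 n 0 + 2 : ℤ) < (p : ℤ) ^ 2)
    (_hfp : FirstPeriod (bRay ts5 n) p) (hfd : dOf (bRay ts5 n) / (p : ℤ) = 1) (hlc : 1 ≤ longCount (bRay ts5 n) p)
    (hM : MatchingR1 (bRay ts5 n) p (longCount (bRay ts5 n) p)) (hcas : casoratian (bRay ts5 n) 7 ≠ 0) :
    ((longCount (bRay ts5 n) p : ℤ) + 1) - pairFloors (bRay ts5 n) p ≤ padicValRat p (casoratian (bRay ts5 n) 7) := by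
  have hp0 : (0 : ℤ) < p := by exact_mod_cast hprime.pos
  -- `⌊39n/p⌋ = 1` forces `39n < 2p`
  have hlo : 39 * n < 2 * p := by
    by_contra hc
    push Not at hc
    have h2 : (2 : ℤ) ≤ dOf (bRay ts5 n) / (p : ℤ) := by
      rw [dOf_lin, Int.le_ediv_iff_mul_le hp0]
      have : (2 * p : ℤ) ≤ 39 * n := by exact_mod_cast hc
      linarith
    omega
  -- `a ≥ 1` forces `p ≤ 21n`, hence `a = 1`; the matching forces `p ≤ 20n`
  have htop := le_top_of_longCount hlc
  have hL1 : longCount (bRay ts5 n) p = 1 := longCount_r1 hlo htop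
  rw [hL1] at hM ⊢
  have hhi : p ≤ 20 * n := by
    have hb : BlockGe (bRay ts5 n) p 2 7 := hM.1
    unfold BlockGe at hb
    rw [w0, w2, w7] at hb
    have : (p : ℤ) ≤ 20 * n := by linarith
    exact_mod_cast this
  have hlt : p < 20 * n := lt_of_le_of_ne hhi (ne_top hprime)
  rw [pairFloors_r1 hlo hhi]
  push_cast
  linarith [ruleR1_cell n p hn hprime (by omega) hlt hcas]

end Summit.KontsevichZagierPeriods.Zeta5Search.StairTS5

namespace Summit.KontsevichZagierPeriods.Zeta5Search.StairTS7

open Summit.KontsevichZagierPeriods.Zeta5Search.ClusterValuation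
open Summit.KontsevichZagierPeriods.Zeta5Search.CasoratianValuation (InPolytope shift casoratian pairFloors refund)
open Summit.KontsevichZagierPeriods.Zeta5Search.WedgeDictionary (dOf)
open Summit.KontsevichZagierPeriods.Zeta5Search.StaircaseCells (bRay ts7)
open Summit.KontsevichZagierPeriods.Zeta5Search.DenomLaw (Sorted7 FirstPeriod BlockGe longCount MatchingR1)

/-! ## TS7: `b(n) = n·(85; 34,32,30,27,25,22,20)`, `d = 65n`; the R1 cell `65n < 2p`, `p ≤ 33n` (`a = 1`, `N_p = 9`, value `−7`) -/

/-- `b_0 = 85n`. -/ theorem w0 (n : ℕ) : bRay ts7 n 0 = 85 * (n : ℤ) := by rw [v0]; push_cast; ring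
/-- `b_1 = 34n`. -/ theorem w1 (n : ℕ) : bRay ts7 n 1 = 34 * (n : ℤ) := by rw [v1]; push_cast; ring
/-- `b_2 = 32n`. -/ theorem w2 (n : ℕ) : bRay ts7 n 2 = 32 * (n : ℤ) := by rw [v2]; push_cast; ring
/-- `b_3 = 30n`. -/ theorem w3 (n : ℕ) : bRay ts7 n 3 = 30 * (n : ℤ) := by rw [v3]; push_cast; ring
/-- `b_4 = 27n`. -/ theorem w4 (n : ℕ) : bRay ts7 n 4 = 27 * (n : ℤ) := by rw [v4]; push_cast; ring
/-- `b_5 = 25n`. -/ theorem w5 (n : ℕ) : bRay ts7 n 5 = 25 * (n : ℤ) := by rw [v5]; push_cast; ring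
/-- `b_6 = 22n`. -/ theorem w6 (n : ℕ) : bRay ts7 n 6 = 22 * (n : ℤ) := by rw [v6]; push_cast; ring
/-- `b_7 = 20n`. -/ theorem w7 (n : ℕ) : bRay ts7 n 7 = 20 * (n : ℤ) := by rw [v7]; push_cast; ring

/-- `d = 65n`. -/
theorem dOf_lin (n : ℕ) : dOf (bRay ts7 n) = 65 * (n : ℤ) := by rw [dOf_ray]; push_cast; ring

/-- On `65n < 2p`, `p ≤ 34n` exactly one parameter reaches `p` (`b₁ = 34n`): `a_p(b(n)) = 1`. -/
theorem longCount_r1 {n p : ℕ} (h1 : 65 * n < 2 * p) (h2 : p ≤ 34 * n) : longCount (bRay ts7 n) p = 1 := by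
  unfold longCount
  rw [card_eq_one]
  refine ⟨0, ?_⟩
  ext i
  simp only [mem_filter, mem_range, mem_singleton]
  constructor
  · rintro ⟨hi, hle⟩
    interval_cases i
    · rfl
    all_goals simp only [Nat.reduceAdd, w2, w3, w4, w5, w6, w7] at hle; omega
  · rintro rfl
    exact ⟨by norm_num, by rw [zero_add, w1]; exact_mod_cast h2⟩

/-- If some parameter reaches `p` then `p ≤ 34n`. -/
theorem le_top_of_longCount {n p : ℕ} (h : 1 ≤ longCount (bRay ts7 n) p) : p ≤ 34 * n := by
  unfold longCount at h
  obtain ⟨i, hi⟩ := card_pos.1 h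
  rw [mem_filter, mem_range] at hi
  obtain ⟨hi7, hle⟩ := hi
  interval_cases i <;> simp only [Nat.reduceAdd, w1, w2, w3, w4, w5, w6, w7] at hle <;> omega

/-- `N_p = 9` on the R1 cell `65n < 2p`, `p ≤ 33n`. -/
theorem pairFloors_r1 {n p : ℕ} (hA : 65 * n < 2 * p) (hB : p ≤ 33 * n) : pairFloors (bRay ts7 n) p = 9 := by
  have hp0 : (0 : ℤ) < p := by exact_mod_cast (show 0 < p by omega)
  have hq0 : ∀ (a b : ℤ) (c : ℕ), (85 : ℤ) - a - b = c → c * n < p →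
      ((85 : ℤ) * n - a * n - b * n) / (p : ℤ) = 0 := by
    intro a b c h h2
    rw [show (85 : ℤ) * n - a * n - b * n = (c : ℤ) * n by rw [← h]; ring]
    exact Int.ediv_eq_zero_of_lt (by positivity) (by exact_mod_cast h2)
  have hq1 : ∀ (a b : ℤ) (c : ℕ), (85 : ℤ) - a - b = c → p ≤ c * n → c * n < 2 * p →
      ((85 : ℤ) * n - a * n - b * n) / (p : ℤ) = 1 := by
    intro a b c h h1 h2
    rw [show (85 : ℤ) * n - a * n - b * n = (c : ℤ) * n by rw [← h]; ring]
    have h1' : (p : ℤ) ≤ c * n := by exact_mod_cast h1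
    have h2' : ((c * n : ℕ) : ℤ) < 2 * p := by exact_mod_cast h2
    push_cast at h2'
    rw [Int.ediv_eq_iff_of_pos hp0]; constructor <;> linarith
  unfold pairFloors
  simp only [sum_range_succ, sum_range_zero, zero_add, Nat.reduceAdd, w0, w1, w2, w3, w4, w5, w6, w7, Nat.lt_irrefl, if_false,
    show (0:ℕ) < 1 by norm_num, show (0:ℕ) < 2 by norm_num, show (0:ℕ) < 3 by norm_num, show (0:ℕ) < 4 by norm_num, show (0:ℕ) < 5 by norm_num,
    show (0:ℕ) < 6 by norm_num, show (1:ℕ) < 2 by norm_num, show (1:ℕ) < 3 by norm_num, show (1:ℕ) < 4 by norm_num, show (1:ℕ) < 5 by norm_num,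
    show (1:ℕ) < 6 by norm_num, show (2:ℕ) < 3 by norm_num, show (2:ℕ) < 4 by norm_num, show (2:ℕ) < 5 by norm_num, show (2:ℕ) < 6 by norm_num,
    show (3:ℕ) < 4 by norm_num, show (3:ℕ) < 5 by norm_num, show (3:ℕ) < 6 by norm_num, show (4:ℕ) < 5 by norm_num, show (4:ℕ) < 6 by norm_num,
    show (5:ℕ) < 6 by norm_num, if_true,
    show ¬ (1:ℕ) < 0 by norm_num, show ¬ (2:ℕ) < 0 by norm_num, show ¬ (3:ℕ) < 0 by norm_num, show ¬ (4:ℕ) < 0 by norm_num, show ¬ (5:ℕ) < 0 by norm_num,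
    show ¬ (6:ℕ) < 0 by norm_num, show ¬ (2:ℕ) < 1 by norm_num, show ¬ (3:ℕ) < 1 by norm_num, show ¬ (4:ℕ) < 1 by norm_num, show ¬ (5:ℕ) < 1 by norm_num,
    show ¬ (6:ℕ) < 1 by norm_num, show ¬ (3:ℕ) < 2 by norm_num, show ¬ (4:ℕ) < 2 by norm_num, show ¬ (5:ℕ) < 2 by norm_num, show ¬ (6:ℕ) < 2 by norm_num,
    show ¬ (4:ℕ) < 3 by norm_num, show ¬ (5:ℕ) < 3 by norm_num, show ¬ (6:ℕ) < 3 by norm_num, show ¬ (5:ℕ) < 4 by norm_num, show ¬ (6:ℕ) < 4 by norm_num,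
    show ¬ (6:ℕ) < 5 by norm_num, add_zero]
  rw [hq0 34 32 19 (by norm_num) (by omega), hq0 34 30 21 (by norm_num) (by omega), hq0 34 27 24 (by norm_num) (by omega), hq0 34 25 26 (by norm_num) (by omega), hq0 34 22 29 (by norm_num) (by omega), hq0 34 20 31 (by norm_num) (by omega), hq0 32 30 23 (by norm_num) (by omega), hq0 32 27 26 (by norm_num) (by omega), hq0 32 25 28 (by norm_num) (by omega), hq0 32 22 31 (by norm_num) (by omega), hq1 32 20 33 (by norm_num) (by omega) (by omega), hq0 30 27 28 (by norm_num) (by omega), hq0 30 25 30 (by norm_num) (by omega), hq1 30 22 33 (by norm_num) (by omega) (by omega), hq1 30 20 35 (by norm_num) (by omega) (by omega), hq1 27 25 33 (by norm_num) (by omega) (by omega), hq1 27 22 36 (by norm_num) (by omega) (by omega), hq1 27 20 38 (by norm_num) (by omega) (by omega), hq1 25 22 38 (by norm_num) (by omega) (by omega), hq1 25 20 40 (by norm_num) (by omega) (by omega), hq1 22 20 43 (by norm_num) (by omega) (by omega)]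
  norm_num

/-- `p = 33n` is impossible for a prime `p`. -/
theorem ne_top {n p : ℕ} (hprime : p.Prime) : p ≠ 33 * n := by
  intro heq
  have h : 3 ∣ p := ⟨11 * n, by omega⟩
  have := (Nat.prime_dvd_prime_iff_eq (by norm_num) hprime).1 h
  omega

/-- **The node `RuleR1Casoratian` restricted to TS7**, literally (all its binders, `b := b(n)`), for every `n ≥ 1`: its hypotheses force the cell
`65n < 2p < 66n` with `a = 1`, `N_p = 9`, where the value `(1 + 1) − 9 = −7` is the landed `RuleR1CellTS7.ruleR1_cell`. -/
theorem ruleR1Casoratian_on_ts7 (n p : ℕ) (hn : 1 ≤ n) (_hb : InPolytope (bRay ts7 n)) (_hs : Sorted7 (bRay ts7 n))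
    (_hb7 : InPolytope (shift (bRay ts7 n) 7)) (hprime : p.Prime) (_hp5 : 5 ≤ p) (_hwin : (bRay ts7 n 0 + 2 : ℤ) < (p : ℤ) ^ 2)
    (_hfp : FirstPeriod (bRay ts7 n) p) (hfd : dOf (bRay ts7 n) / (p : ℤ) = 1) (hlc : 1 ≤ longCount (bRay ts7 n) p)
    (hM : MatchingR1 (bRay ts7 n) p (longCount (bRay ts7 n) p)) (hcas : casoratian (bRay ts7 n) 7 ≠ 0) :
    ((longCount (bRay ts7 n) p : ℤ) + 1) - pairFloors (bRay ts7 n) p ≤ padicValRat p (casoratian (bRay ts7 n) 7) := by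
  have hp0 : (0 : ℤ) < p := by exact_mod_cast hprime.pos
  -- `⌊65n/p⌋ = 1` forces `65n < 2p`
  have hlo : 65 * n < 2 * p := by
    by_contra hc
    push Not at hc
    have h2 : (2 : ℤ) ≤ dOf (bRay ts7 n) / (p : ℤ) := by
      rw [dOf_lin, Int.le_ediv_iff_mul_le hp0]
      have : (2 * p : ℤ) ≤ 65 * n := by exact_mod_cast hc
      linarith
    omega
  -- `a ≥ 1` forces `p ≤ 34n`, hence `a = 1`; the matching forces `p ≤ 33n`
  have htop := le_top_of_longCount hlc
  have hL1 : longCount (bRay ts7 n) p = 1 := longCount_r1 hlo htop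
  rw [hL1] at hM ⊢
  have hhi : p ≤ 33 * n := by
    have hb : BlockGe (bRay ts7 n) p 2 7 := hM.1
    unfold BlockGe at hb
    rw [w0, w2, w7] at hb
    have : (p : ℤ) ≤ 33 * n := by linarith
    exact_mod_cast this
  have hlt : p < 33 * n := lt_of_le_of_ne hhi (ne_top hprime)
  rw [pairFloors_r1 hlo hhi]
  push_cast
  linarith [ruleR1_cell n p hn hprime (by omega) hlt hcas]

end Summit.KontsevichZagierPeriods.Zeta5Search.StairTS7

namespace Summit.KontsevichZagierPeriods.Zeta5Search.StairTS10

open Summit.KontsevichZagierPeriods.Zeta5Search.ClusterValuation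
open Summit.KontsevichZagierPeriods.Zeta5Search.CasoratianValuation (InPolytope shift casoratian pairFloors refund)
open Summit.KontsevichZagierPeriods.Zeta5Search.WedgeDictionary (dOf)
open Summit.KontsevichZagierPeriods.Zeta5Search.StaircaseCells (bRay ts10)
open Summit.KontsevichZagierPeriods.Zeta5Search.DenomLaw (Sorted7 FirstPeriod BlockGe longCount MatchingR1)

/-! ## TS10: `b(n) = n·(85; 35,32,30,27,25,22,19)`, `d = 65n`; the R1 cell `65n < 2p`, `p ≤ 33n` (`a = 1`, `N_p = 9`, value `−7`) -/

/-- `b_0 = 85n`. -/ theorem w0 (n : ℕ) : bRay ts10 n 0 = 85 * (n : ℤ) := by rw [v0]; push_cast; ring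
/-- `b_1 = 35n`. -/ theorem w1 (n : ℕ) : bRay ts10 n 1 = 35 * (n : ℤ) := by rw [v1]; push_cast; ring
/-- `b_2 = 32n`. -/ theorem w2 (n : ℕ) : bRay ts10 n 2 = 32 * (n : ℤ) := by rw [v2]; push_cast; ring
/-- `b_3 = 30n`. -/ theorem w3 (n : ℕ) : bRay ts10 n 3 = 30 * (n : ℤ) := by rw [v3]; push_cast; ring
/-- `b_4 = 27n`. -/ theorem w4 (n : ℕ) : bRay ts10 n 4 = 27 * (n : ℤ) := by rw [v4]; push_cast; ring
/-- `b_5 = 25n`. -/ theorem w5 (n : ℕ) : bRay ts10 n 5 = 25 * (n : ℤ) := by rw [v5]; push_cast; ring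
/-- `b_6 = 22n`. -/ theorem w6 (n : ℕ) : bRay ts10 n 6 = 22 * (n : ℤ) := by rw [v6]; push_cast; ring
/-- `b_7 = 19n`. -/ theorem w7 (n : ℕ) : bRay ts10 n 7 = 19 * (n : ℤ) := by rw [v7]; push_cast; ring

/-- `d = 65n`. -/
theorem dOf_lin (n : ℕ) : dOf (bRay ts10 n) = 65 * (n : ℤ) := by rw [dOf_ray]; push_cast; ring

/-- On `65n < 2p`, `p ≤ 35n` exactly one parameter reaches `p` (`b₁ = 35n`): `a_p(b(n)) = 1`. -/
theorem longCount_r1 {n p : ℕ} (h1 : 65 * n < 2 * p) (h2 : p ≤ 35 * n) : longCount (bRay ts10 n) p = 1 := by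
  unfold longCount
  rw [card_eq_one]
  refine ⟨0, ?_⟩
  ext i
  simp only [mem_filter, mem_range, mem_singleton]
  constructor
  · rintro ⟨hi, hle⟩
    interval_cases i
    · rfl
    all_goals simp only [Nat.reduceAdd, w2, w3, w4, w5, w6, w7] at hle; omega
  · rintro rfl
    exact ⟨by norm_num, by rw [zero_add, w1]; exact_mod_cast h2⟩

/-- If some parameter reaches `p` then `p ≤ 35n`. -/
theorem le_top_of_longCount {n p : ℕ} (h : 1 ≤ longCount (bRay ts10 n) p) : p ≤ 35 * n := by
  unfold longCount at h
  obtain ⟨i, hi⟩ := card_pos.1 h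
  rw [mem_filter, mem_range] at hi
  obtain ⟨hi7, hle⟩ := hi
  interval_cases i <;> simp only [Nat.reduceAdd, w1, w2, w3, w4, w5, w6, w7] at hle <;> omega

/-- `N_p = 9` on the R1 cell `65n < 2p`, `p ≤ 33n`. -/
theorem pairFloors_r1 {n p : ℕ} (hA : 65 * n < 2 * p) (hB : p ≤ 33 * n) : pairFloors (bRay ts10 n) p = 9 := by
  have hp0 : (0 : ℤ) < p := by exact_mod_cast (show 0 < p by omega)
  have hq0 : ∀ (a b : ℤ) (c : ℕ), (85 : ℤ) - a - b = c → c * n < p →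
      ((85 : ℤ) * n - a * n - b * n) / (p : ℤ) = 0 := by
    intro a b c h h2
    rw [show (85 : ℤ) * n - a * n - b * n = (c : ℤ) * n by rw [← h]; ring]
    exact Int.ediv_eq_zero_of_lt (by positivity) (by exact_mod_cast h2)
  have hq1 : ∀ (a b : ℤ) (c : ℕ), (85 : ℤ) - a - b = c → p ≤ c * n → c * n < 2 * p →
      ((85 : ℤ) * n - a * n - b * n) / (p : ℤ) = 1 := by
    intro a b c h h1 h2
    rw [show (85 : ℤ) * n - a * n - b * n = (c : ℤ) * n by rw [← h]; ring]
    have h1' : (p : ℤ) ≤ c * n := by exact_mod_cast h1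
    have h2' : ((c * n : ℕ) : ℤ) < 2 * p := by exact_mod_cast h2
    push_cast at h2'
    rw [Int.ediv_eq_iff_of_pos hp0]; constructor <;> linarith
  unfold pairFloors
  simp only [sum_range_succ, sum_range_zero, zero_add, Nat.reduceAdd, w0, w1, w2, w3, w4, w5, w6, w7, Nat.lt_irrefl, if_false,
    show (0:ℕ) < 1 by norm_num, show (0:ℕ) < 2 by norm_num, show (0:ℕ) < 3 by norm_num, show (0:ℕ) < 4 by norm_num, show (0:ℕ) < 5 by norm_num,
    show (0:ℕ) < 6 by norm_num, show (1:ℕ) < 2 by norm_num, show (1:ℕ) < 3 by norm_num, show (1:ℕ) < 4 by norm_num, show (1:ℕ) < 5 by norm_num,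
    show (1:ℕ) < 6 by norm_num, show (2:ℕ) < 3 by norm_num, show (2:ℕ) < 4 by norm_num, show (2:ℕ) < 5 by norm_num, show (2:ℕ) < 6 by norm_num,
    show (3:ℕ) < 4 by norm_num, show (3:ℕ) < 5 by norm_num, show (3:ℕ) < 6 by norm_num, show (4:ℕ) < 5 by norm_num, show (4:ℕ) < 6 by norm_num,
    show (5:ℕ) < 6 by norm_num, if_true,
    show ¬ (1:ℕ) < 0 by norm_num, show ¬ (2:ℕ) < 0 by norm_num, show ¬ (3:ℕ) < 0 by norm_num, show ¬ (4:ℕ) < 0 by norm_num, show ¬ (5:ℕ) < 0 by norm_num,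
    show ¬ (6:ℕ) < 0 by norm_num, show ¬ (2:ℕ) < 1 by norm_num, show ¬ (3:ℕ) < 1 by norm_num, show ¬ (4:ℕ) < 1 by norm_num, show ¬ (5:ℕ) < 1 by norm_num,
    show ¬ (6:ℕ) < 1 by norm_num, show ¬ (3:ℕ) < 2 by norm_num, show ¬ (4:ℕ) < 2 by norm_num, show ¬ (5:ℕ) < 2 by norm_num, show ¬ (6:ℕ) < 2 by norm_num,
    show ¬ (4:ℕ) < 3 by norm_num, show ¬ (5:ℕ) < 3 by norm_num, show ¬ (6:ℕ) < 3 by norm_num, show ¬ (5:ℕ) < 4 by norm_num, show ¬ (6:ℕ) < 4 by norm_num,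
    show ¬ (6:ℕ) < 5 by norm_num, add_zero]
  rw [hq0 35 32 18 (by norm_num) (by omega), hq0 35 30 20 (by norm_num) (by omega), hq0 35 27 23 (by norm_num) (by omega), hq0 35 25 25 (by norm_num) (by omega), hq0 35 22 28 (by norm_num) (by omega), hq0 35 19 31 (by norm_num) (by omega), hq0 32 30 23 (by norm_num) (by omega), hq0 32 27 26 (by norm_num) (by omega), hq0 32 25 28 (by norm_num) (by omega), hq0 32 22 31 (by norm_num) (by omega), hq1 32 19 34 (by norm_num) (by omega) (by omega), hq0 30 27 28 (by norm_num) (by omega), hq0 30 25 30 (by norm_num) (by omega), hq1 30 22 33 (by norm_num) (by omega) (by omega), hq1 30 19 36 (by norm_num) (by omega) (by omega), hq1 27 25 33 (by norm_num) (by omega) (by omega), hq1 27 22 36 (by norm_num) (by omega) (by omega), hq1 27 19 39 (by norm_num) (by omega) (by omega), hq1 25 22 38 (by norm_num) (by omega) (by omega), hq1 25 19 41 (by norm_num) (by omega) (by omega), hq1 22 19 44 (by norm_num) (by omega) (by omega)]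
  norm_num

/-- `p = 33n` is impossible for a prime `p`. -/
theorem ne_top {n p : ℕ} (hprime : p.Prime) : p ≠ 33 * n := by
  intro heq
  have h : 3 ∣ p := ⟨11 * n, by omega⟩
  have := (Nat.prime_dvd_prime_iff_eq (by norm_num) hprime).1 h
  omega

/-- **The node `RuleR1Casoratian` restricted to TS10**, literally (all its binders, `b := b(n)`), for every `n ≥ 1`: its hypotheses force the cell
`65n < 2p < 66n` with `a = 1`, `N_p = 9`, where the value `(1 + 1) − 9 = −7` is the landed `RuleR1CellTS10.ruleR1_cell`. -/
theorem ruleR1Casoratian_on_ts10 (n p : ℕ) (hn : 1 ≤ n) (_hb : InPolytope (bRay ts10 n)) (_hs : Sorted7 (bRay ts10 n))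
    (_hb7 : InPolytope (shift (bRay ts10 n) 7)) (hprime : p.Prime) (_hp5 : 5 ≤ p) (_hwin : (bRay ts10 n 0 + 2 : ℤ) < (p : ℤ) ^ 2)
    (_hfp : FirstPeriod (bRay ts10 n) p) (hfd : dOf (bRay ts10 n) / (p : ℤ) = 1) (hlc : 1 ≤ longCount (bRay ts10 n) p)
    (hM : MatchingR1 (bRay ts10 n) p (longCount (bRay ts10 n) p)) (hcas : casoratian (bRay ts10 n) 7 ≠ 0) :
    ((longCount (bRay ts10 n) p : ℤ) + 1) - pairFloors (bRay ts10 n) p ≤ padicValRat p (casoratian (bRay ts10 n) 7) := by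
  have hp0 : (0 : ℤ) < p := by exact_mod_cast hprime.pos
  -- `⌊65n/p⌋ = 1` forces `65n < 2p`
  have hlo : 65 * n < 2 * p := by
    by_contra hc
    push Not at hc
    have h2 : (2 : ℤ) ≤ dOf (bRay ts10 n) / (p : ℤ) := by
      rw [dOf_lin, Int.le_ediv_iff_mul_le hp0]
      have : (2 * p : ℤ) ≤ 65 * n := by exact_mod_cast hc
      linarith
    omega
  -- `a ≥ 1` forces `p ≤ 35n`, hence `a = 1`; the matching forces `p ≤ 33n`
  have htop := le_top_of_longCount hlc
  have hL1 : longCount (bRay ts10 n) p = 1 := longCount_r1 hlo htop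
  rw [hL1] at hM ⊢
  have hhi : p ≤ 33 * n := by
    have hb : BlockGe (bRay ts10 n) p 3 6 := hM.2.1
    unfold BlockGe at hb
    rw [w0, w3, w6] at hb
    have : (p : ℤ) ≤ 33 * n := by linarith
    exact_mod_cast this
  have hlt : p < 33 * n := lt_of_le_of_ne hhi (ne_top hprime)
  rw [pairFloors_r1 hlo hhi]
  push_cast
  linarith [ruleR1_cell n p hn hprime (by omega) hlt hcas]

end Summit.KontsevichZagierPeriods.Zeta5Search.StairTS10
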